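import Mathlib

/-!
# Twin H₁ dictionary — combinatorial shadow of the TWIN RIGIDITY THEOREM for ⊠-cells (plan-lens-HodgeAV-embed g4; BOOKKEEPING ONLY)

HONEST FRAMING. Companion of `Cruxes/BlochSeedDiscOne/TWIN-H1-DICTIONARY-embed-g4.md` §3–§4. Nothing here is proved toward
HC ∕ HC_CM ∕ HC_AV ∕ № 4 ∕ 26512 ∕ 18881 ∕ H2; no variety, sheaf, cohomology group or obstruction map is constructed. The memo's
pencil content (the PLANE LEMMA via Mumford's index theorem, and the first-order demand formula of PAD4-FIRSTORDER §1 transplanted to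
the four VIRTUAL FACTORS of a twin frame) is NOT formalised. What is kernel-checked is the last, finite step of the memo's §4: once the
demand of a ⊠-cell `x ⊠ y` of O_L-Hermitian letters is written slot by slot through the four virtual blocks
`(a₁,a₂,σ₁βx), (a₂,a₁,σ_tβ̄x), (b₁,b₂,σ₁βy), (b₂,b₁,σ_tβ̄y)` (memo §1), the vanishing of the coefficients in the eight UNSUPPLIED slots
(the four `Λ²V_g` slots, coefficient `α′_g − α_g`, and the four INTER-factor slots, matrix entries `β̄_j, α′_j − α_g, β_g, α′_g − α_j`)
is equivalent to the cell being scalar (`a₁ = a₂ = b₁ = b₂`, `βx = βy = 0`) — i.e. RULE D₀ of the memo. Conjugation is dropped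
(only `β = 0` matters); the Galois images of `β` are kept as opaque ring elements. No `sorry`, no new axioms, no instances, no notation.
-/

namespace Summit.HodgeConjecture.HodgeConjecture.Cruxes.BlochSeedDiscOne.TwinRigidity

/-- A virtual record block `(α, α′, β)` (memo §1 table); `β` is an opaque ring element (a Galois image of the letter's off-diagonal entry). -/
structure VBlock (R : Type*) where
  α : ℤ
  α' : ℤ
  β : R

/-- A ⊠-cell `x ⊠ y`, `x = [[a₁, βx],[β̄x, a₂]]` on twin factor 0, `y = [[b₁, βy],[β̄y, b₂]]` on twin factor 1, with the two Galois images of each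
off-diagonal entry (`βx₁ = σ₁ βx`, `βxt = σ_t β̄x`, same for `y`). -/
structure TwinCell (R : Type*) where
  a₁ : ℤ
  a₂ : ℤ
  b₁ : ℤ
  b₂ : ℤ
  βx₁ : R
  βxt : R
  βy₁ : R
  βyt : R

variable {R : Type*} [CommRing R]

/-- The four virtual blocks, indexed `0 = (0,1)`, `1 = (0,t)`, `2 = (1,1)`, `3 = (1,t)` (memo §1: the `t`-world block has its diagonal SWAPPED). -/
def block (X : TwinCell R) (g : Fin 4) : VBlock R :=
  if g.val = 0 then ⟨X.a₁, X.a₂, X.βx₁⟩ else if g.val = 1 then ⟨X.a₂, X.a₁, X.βxt⟩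
  else if g.val = 2 then ⟨X.b₁, X.b₂, X.βy₁⟩ else ⟨X.b₂, X.b₁, X.βyt⟩

/-- The twin factor of a virtual factor. -/
def fac (g : Fin 4) : ℕ := if g.val < 2 then 0 else 1

/-- `Λ²V_g`-slot coefficient `α′_g − α_g` (it multiplies the free Weil-tangent entry `k_gg`). -/
def lam2Coeff (X : TwinCell R) (g : Fin 4) : ℤ := (block X g).α' - (block X g).α

/-- The slot-`(g,j)` demand `k_{jg}·[[β̄_j, α′_j − α_g],[0, −β_g]] + k_{gj}·[[−β̄_g, 0],[−(α′_g − α_j), β_j]]` vanishes for all `k_{jg}, k_{gj}`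
iff these entries vanish. -/
def SlotVanishes (X : TwinCell R) (g j : Fin 4) : Prop :=
  (block X j).β = 0 ∧ (block X j).α' = (block X g).α ∧ (block X g).β = 0 ∧ (block X g).α' = (block X j).α

/-- RULE D₀ for one bound cell: the demand vanishes in every UNSUPPLIED slot of a ⊠-design (TWIN SUPPLY COROLLARY: the four `Λ²V_g` slots and
the four inter-factor slots receive no partner planes). -/
def UnsuppliedVanish (X : TwinCell R) : Prop :=
  (∀ g, lam2Coeff X g = 0) ∧ ∀ g j, fac g ≠ fac j → SlotVanishes X g j

/-- The scalar cell `τ·h`. -/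
def IsScalar (X : TwinCell R) : Prop :=
  X.a₁ = X.a₂ ∧ X.a₂ = X.b₁ ∧ X.b₁ = X.b₂ ∧ X.βx₁ = 0 ∧ X.βxt = 0 ∧ X.βy₁ = 0 ∧ X.βyt = 0

/-- TWIN RIGIDITY, ⊠-cell shadow (memo §3 (V3) ∕ §4): a bound cell passes the unsupplied-slot test iff it is `τ·h`. -/
theorem unsuppliedVanish_iff_isScalar (X : TwinCell R) : UnsuppliedVanish X ↔ IsScalar X := by
  constructor
  · rintro ⟨hΛ, hI⟩
    have h02 := hI ⟨0, by omega⟩ ⟨2, by omega⟩ (by simp [fac])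
    have h03 := hI ⟨0, by omega⟩ ⟨3, by omega⟩ (by simp [fac])
    have h12 := hI ⟨1, by omega⟩ ⟨2, by omega⟩ (by simp [fac])
    have hΛ0 := hΛ ⟨0, by omega⟩
    simp only [SlotVanishes, block, lam2Coeff] at h02 h03 h12 hΛ0
    norm_num at h02 h03 h12 hΛ0
    obtain ⟨hy1, e1, hx1, e2⟩ := h02
    obtain ⟨hyt, e3, -, e4⟩ := h03
    obtain ⟨-, -, hxt, -⟩ := h12
    exact ⟨by omega, by omega, by omega, hx1, hxt, hy1, hyt⟩
  · rintro ⟨h1, h2, h3, hx1, hxt, hy1, hyt⟩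
    refine ⟨?_, ?_⟩
    · intro g
      fin_cases g <;> simp [lam2Coeff, block] <;> omega
    · intro g j hgj
      fin_cases g <;> fin_cases j <;> simp_all [SlotVanishes, block, fac]

/-- Consequently a cell charged on twin factor 0 (`σ₁ βx ≠ 0`) never passes — the (H1)-carrying cells of memo §5 are all of this kind. -/
theorem not_unsuppliedVanish_of_charged (X : TwinCell R) (h : X.βx₁ ≠ 0) : ¬ UnsuppliedVanish X := fun hU =>
  h ((unsuppliedVanish_iff_isScalar X).1 hU).2.2.2.1

/-- … and an unbalanced cell (`a₁ ≠ a₂`, e.g. `D01 ⊠ D00`) never passes either (the superseded «balance law» is the `Λ²`-half of rigidity). -/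
theorem not_unsuppliedVanish_of_unbalanced (X : TwinCell R) (h : X.a₁ ≠ X.a₂) : ¬ UnsuppliedVanish X := fun hU =>
  h ((unsuppliedVanish_iff_isScalar X).1 hU).1

end Summit.HodgeConjecture.HodgeConjecture.Cruxes.BlochSeedDiscOne.TwinRigidity
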